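import Literature.NumberTheory.GaloisRepresentations.IdeleReadoutLocalHom
import Literature.NumberTheory.GaloisRepresentations.IdeleReadoutArchLocalHom
import Literature.NumberTheory.GaloisRepresentations.IdeleCohomologyLimit
import Literature.NumberTheory.GaloisRepresentations.GlobalNormIndexIdelic
import HarnessLib

/-!
# The place readouts `π_v : J_E → K̄_vˣ` of the idèle group of a Galois layer at every place of the base field
# (finite: through `E_{w_v} → K̄_v`; infinite: through `E_{w_v} → K̄_v`), their `Γ_{K_v}`-equivariance, and their values on
# principal idèles (Cassels–Fröhlich VII §1.1, §7.3; Milne *ADT* I Lemma 4.13)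

Topic `NumberTheory/GaloisRepresentations`; namespace `Literature.NumberTheory.GaloisRepresentations.IdeleReadout`.
Definitions with bodies and theorems; NO named fact, no `sorry`, no instance, no notation; number fields in `Type`.
Sequel to door-c5 g17's `IdeleReadoutLocalHom` / `IdeleReadoutArchLocalHom` (`localReadout`, `archLocalReadout` of a
`G`-morphism into a semi-local block) applied to the place projections `placeProj v : J_E ⟶ ∏_{w∣v} E_wˣ`,
`infPlaceProj v` of `IdeleCohomologyLimit`.

Why (Route A of crux `AnticycControlAdditiveK`, item 19295; door-c6 g16 presentation road, (R-def): "`π_v : J̄ → K̄_vˣ`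
additive, `res_v`-equivariant, `π_v ∘ unitsToIdele = ι_v`" — FINDING-door-c6-g16 §5, design (b): at the single layer
`E₀`, enough since `Hom_{C_Γ}(N₁, J̄) = Hom_{Gal(E₀/K)}(N₁, J_{E₀})` by `GalLayerData.layerLift`).  For a finite Galois `E/K`
with `ιE : E → K̄` and a place `v` of `K`, `π_v` is the `w_v`-component of an idèle followed by the distinguished
embedding `E_{w_v} → K̄_v` (`SemiLocal.placeEmb` / `archPlaceEmb`).  It is additive, equivariant for `Γ_{K_v}` acting on
`J_E` through `d ↦ d|_E` (`Gal(E/K)`) and on `K̄_vˣ` naturally, sends the principal idèle of `e ∈ Eˣ` to `ι_v (ιE e)`, and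
at a finite place detects local units: `‖π_v x‖ = 1 ↔ x_{w_v} ∈ 𝒪_{w_v}ˣ`.  The readout of a `G`-morphism
`Φ : X ⟶ J_E` at `v` (`localReadout v ιE (Φ ≫ placeProj v)`) is `π_v ∘ Φ`.

## What is formalised (`K E : Type` number fields, `[IsGalois K E]`, `ιE : E →ₐ[K] K̄`)

* finite `v`: **`idelePlaceReadout v ιE : Additive J_E →+ UnitsCarrier K_v`** (`= localReadout v ιE (placeProj v)`),
  `coe_unitsVal_idelePlaceReadout` (`= placeEmb (x_{w_v})`), **`idelePlaceReadout_smul`** (equivariance),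
  **`idelePlaceReadout_principal`** (`π_v (e) = ι_v (ιE e)`), **`algNorm_idelePlaceReadout_eq_one_iff`**
  (`‖π_v x‖ = 1 ↔ v_{w_v}(x_{w_v}) = 1`), `algNorm_idelePlaceReadout_eq_one_of_mem_ideleS`,
  `localReadout_comp_placeProj_apply` (`localReadout (Φ ≫ placeProj v) x = π_v (Φ x)`).
* infinite `v`: **`ideleInfPlaceReadout v ιE`**, `coe_unitsVal_ideleInfPlaceReadout`, **`ideleInfPlaceReadout_smul`**,
  **`ideleInfPlaceReadout_principal`**, `archLocalReadout_comp_infPlaceProj_apply`.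

## References
* J. W. S. Cassels, A. Fröhlich (eds.), *Algebraic Number Theory* (1967), Ch. VII (Tate) §1.1, §7.3. [CasselsFrohlichANT1967]
* J. S. Milne, *Arithmetic Duality Theorems* (2nd ed. 2006), I Lemma 4.13 (proof), I §4. [MilneADT2006]
-/

noncomputable section

open NumberField NumberField.InfinitePlace IsDedekindDomain Field CategoryTheory
open Literature.NumberTheory.Automorphic

namespace Literature.NumberTheory.GaloisRepresentations

namespace IdeleReadout

open SemiLocal ArchHerbrand DiscreteGaloisModule IdeleCohomology

variable {K : Type} [Field K] [NumberField K] {E : Type} [Field E] [NumberField E] [Algebra K E] [IsGalois K E]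

/-! ## §1. Finite places -/

section Finite

variable (v : HeightOneSpectrum (𝓞 K)) (ιE : E →ₐ[K] AlgebraicClosure K)

/-- **`π_v : J_E → K̄_vˣ` at a finite place `v`**: the `w_v`-component followed by `placeEmb : E_{w_v} → K̄_v` (the local
readout of the place projection `J_E ⟶ ∏_{w∣v} E_wˣ`). [cite: CasselsFrohlichANT1967, Ch. VII §7.3] [cite: MilneADT2006, I Lemma 4.13 (proof)] -/
def idelePlaceReadout : Additive (ideleGroup E) →+ UnitsCarrier (v.adicCompletion K) :=
  localReadout v ιE (X := IdeleClassGroup.ideleRep K E) (placeProj v)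

/-- Unfolding: `π_v x = placeEmb (x_{w_v})` in `K̄_v`. [cite: CasselsFrohlichANT1967, Ch. VII §7.3] -/
theorem coe_unitsVal_idelePlaceReadout (x : Additive (ideleGroup E)) :
    (unitsVal (v.adicCompletion K) (idelePlaceReadout v ιE x) : AlgebraicClosure (v.adicCompletion K)) =
      placeEmb v ιE (((Additive.toMul x : ideleGroup E) : AdeleRing (𝓞 E) E).2
        ((embPlace v ιE : Place K E v) : HeightOneSpectrum (𝓞 E))) := rfl

/-- **The readout of a `G`-morphism `Φ : X ⟶ J_E` at `v` is `π_v ∘ Φ`.** [cite: MilneADT2006, I Lemma 4.13 (proof)] -/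
theorem localReadout_comp_placeProj_apply {X : Rep.{0} ℤ (E ≃ₐ[K] E)} (Φ : X ⟶ IdeleClassGroup.ideleRep K E)
    (x : X.V) : localReadout v ιE (Φ ≫ placeProj v) x = idelePlaceReadout v ιE (Φ.hom x) := rfl

/-- **Equivariance: `π_v (d|_E • x) = d • π_v x`** for `d ∈ Γ_{K_v}` (`d|_E = galRestrict v ιE d ∈ Gal(E/K)`).
[cite: CasselsFrohlichANT1967, Ch. VII §1.1] -/
theorem idelePlaceReadout_smul (d : absoluteGaloisGroup (v.adicCompletion K)) (x : ideleGroup E) :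
    idelePlaceReadout v ιE (Additive.ofMul (galRestrict v ιE d • x)) =
      units (v.adicCompletion K) d (idelePlaceReadout v ιE (Additive.ofMul x)) :=
  isLocalHom_localReadout v ιE (X := IdeleClassGroup.ideleRep K E) (placeProj v) d (Additive.ofMul x)

/-- **`π_v` of a principal idèle: `π_v ((e)) = ι_v (ιE e)`.** [cite: CasselsFrohlichANT1967, Ch. VII §7.3] -/
theorem coe_unitsVal_idelePlaceReadout_principal (e : Eˣ) :
    (unitsVal (v.adicCompletion K) (idelePlaceReadout v ιE (Additive.ofMul (IdeleHerbrand.principal E e))) :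
        AlgebraicClosure (v.adicCompletion K)) = absClosureEmbedding K (v.adicCompletion K) (ιE e) := by
  rw [coe_unitsVal_idelePlaceReadout, toMul_ofMul]
  exact placeEmb_coe v ιE (e : E)

/-- The same as an equality in `UnitsCarrier K_v`. [cite: CasselsFrohlichANT1967, Ch. VII §7.3] -/
theorem idelePlaceReadout_principal (e : Eˣ) :
    idelePlaceReadout v ιE (Additive.ofMul (IdeleHerbrand.principal E e)) =
      UnitsCarrier.ofUnits (Units.map ((absClosureEmbedding K (v.adicCompletion K)).toRingHom.toMonoidHom.comp
        (ιE : E →+* AlgebraicClosure K).toMonoidHom) e) :=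
  unitsVal_injective _ (Units.ext (coe_unitsVal_idelePlaceReadout_principal v ιE e))

/-- **`‖π_v x‖ = 1 ↔ x_{w_v} ∈ 𝒪_{w_v}ˣ`** (unit transport `mem_placeUnitGroup_iff_algNorm_placeEmb`).
[cite: CasselsFrohlichANT1967, Ch. VII §7.3] [cite: SerreLocalFields1979, Ch. II §2 Cor. 4] -/
theorem algNorm_idelePlaceReadout_eq_one_iff (x : ideleGroup E) :
    IsNonarchimedeanLocalField.algNorm (v.adicCompletion K)
        (unitsVal (v.adicCompletion K) (idelePlaceReadout v ιE (Additive.ofMul x)) : AlgebraicClosure (v.adicCompletion K)) = 1 ↔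
      Valued.v ((x : AdeleRing (𝓞 E) E).2 ((embPlace v ιE : Place K E v) : HeightOneSpectrum (𝓞 E))) = 1 := by
  change IsNonarchimedeanLocalField.algNorm (v.adicCompletion K) (placeEmb v ιE
    ((Additive.toMul (unitsProj (embPlace v ιE) ((placeProj v).hom (Additive.ofMul x))) :
      (((embPlace v ιE : Place K E v) : HeightOneSpectrum (𝓞 E)).adicCompletion E)ˣ) :
        ((embPlace v ιE : Place K E v) : HeightOneSpectrum (𝓞 E)).adicCompletion E)) = 1 ↔ _
  rw [← mem_placeUnitGroup_iff_algNorm_placeEmb, mem_placeUnitGroup_iff]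
  rfl

/-- On `J_{E,S}` with `v ∉ S` the readout is unit-valued. [cite: CasselsFrohlichANT1967, Ch. VII §7.3] -/
theorem algNorm_idelePlaceReadout_eq_one_of_mem_ideleS {S : Finset (HeightOneSpectrum (𝓞 K))} {x : ideleGroup E}
    (hx : x ∈ ideleS K E S) (hv : v ∉ S) :
    IsNonarchimedeanLocalField.algNorm (v.adicCompletion K)
      (unitsVal (v.adicCompletion K) (idelePlaceReadout v ιE (Additive.ofMul x)) : AlgebraicClosure (v.adicCompletion K)) = 1 := by
  rw [algNorm_idelePlaceReadout_eq_one_iff]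
  exact hx _ (by rw [(embPlace v ιE).under_eq]; exact hv)

end Finite

/-! ## §2. Infinite places -/

section Infinite

variable (v : InfinitePlace K) (ιE : E →ₐ[K] AlgebraicClosure K)

/-- **`π_v : J_E → K̄_vˣ` at an infinite place `v`**: the `w_v`-component of the archimedean part followed by
`archPlaceEmb : E_{w_v} → K̄_v`. [cite: CasselsFrohlichANT1967, Ch. VII §7.3] [cite: MilneADT2006, I Lemma 4.13 (proof)] -/
def ideleInfPlaceReadout : Additive (ideleGroup E) →+ UnitsCarrier v.Completion :=
  archLocalReadout v ιE (X := IdeleClassGroup.ideleRep K E) (infPlaceProj v)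

/-- Unfolding: `π_v x = archPlaceEmb (x_{w_v})` in `K̄_v`. [cite: CasselsFrohlichANT1967, Ch. VII §7.3] -/
theorem coe_unitsVal_ideleInfPlaceReadout (x : Additive (ideleGroup E)) :
    (unitsVal v.Completion (ideleInfPlaceReadout v ιE x) : AlgebraicClosure v.Completion) =
      archPlaceEmb v ιE (((Additive.toMul x : ideleGroup E) : AdeleRing (𝓞 E) E).1 (archEmbPlace v ιE)) := by
  change archPlaceEmb v ιE ((((cutoff E v (IdeleHerbrand.infHom E (Additive.toMul x)) : infUnits E v) :
    (InfiniteAdeleRing E)ˣ) : InfiniteAdeleRing E) (archEmbPlace v ιE)) = _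
  rw [coe_cutoff_apply_of_isOver _ (isOver_archEmbPlace v ιE)]
  rfl

/-- **The readout of a `G`-morphism `Φ : X ⟶ J_E` at an infinite `v` is `π_v ∘ Φ`.** [cite: MilneADT2006, I Lemma 4.13 (proof)] -/
theorem archLocalReadout_comp_infPlaceProj_apply {X : Rep.{0} ℤ (E ≃ₐ[K] E)} (Φ : X ⟶ IdeleClassGroup.ideleRep K E)
    (x : X.V) : archLocalReadout v ιE (Φ ≫ infPlaceProj v) x = ideleInfPlaceReadout v ιE (Φ.hom x) := rfl

/-- **Equivariance: `π_v (d|_E • x) = d • π_v x`** for `d ∈ Γ_{K_v}` at an infinite place.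
[cite: CasselsFrohlichANT1967, Ch. VII §1.1] -/
theorem ideleInfPlaceReadout_smul (d : absoluteGaloisGroup v.Completion) (x : ideleGroup E) :
    ideleInfPlaceReadout v ιE (Additive.ofMul (galRestrictField v.Completion ιE d • x)) =
      units v.Completion d (ideleInfPlaceReadout v ιE (Additive.ofMul x)) :=
  isArchLocalHom_archLocalReadout v ιE (X := IdeleClassGroup.ideleRep K E) (infPlaceProj v) d (Additive.ofMul x)

/-- **`π_v` of a principal idèle at an infinite place: `π_v ((e)) = ι_v (ιE e)`.** [cite: CasselsFrohlichANT1967, Ch. VII §7.3] -/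
theorem coe_unitsVal_ideleInfPlaceReadout_principal (e : Eˣ) :
    (unitsVal v.Completion (ideleInfPlaceReadout v ιE (Additive.ofMul (IdeleHerbrand.principal E e))) :
        AlgebraicClosure v.Completion) = absClosureEmbedding K v.Completion (ιE e) := by
  rw [coe_unitsVal_ideleInfPlaceReadout, toMul_ofMul]
  exact archPlaceEmb_coe v ιE (e : E)

/-- The same as an equality in `UnitsCarrier K_v`. [cite: CasselsFrohlichANT1967, Ch. VII §7.3] -/
theorem ideleInfPlaceReadout_principal (e : Eˣ) :
    ideleInfPlaceReadout v ιE (Additive.ofMul (IdeleHerbrand.principal E e)) =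
      UnitsCarrier.ofUnits (Units.map ((absClosureEmbedding K v.Completion).toRingHom.toMonoidHom.comp
        (ιE : E →+* AlgebraicClosure K).toMonoidHom) e) :=
  unitsVal_injective _ (Units.ext (coe_unitsVal_ideleInfPlaceReadout_principal v ιE e))

end Infinite

end IdeleReadout

end Literature.NumberTheory.GaloisRepresentations

end
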